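import Literature.MathematicalPhysics.QuantumLattice.YangMillsHeatFlowGradientBochner
import HarnessLib

/-!
# Heat-type sections along the Yang–Mills heat flow: commuting `∇_A` through `∂ₜ − Δ_A`

QuantumLattice support file (everything proved; no definitions, no named facts) on the proof
path of `Literature.MathematicalPhysics.QuantumLattice.Waldron2019_yangMillsFlow_flatTorus`
(A. Waldron, Invent. math. 217 (2019)), §3: the generic mechanism behind the derivative
estimates of Prop. 3.1 ([instantons] Lemma 3.1 / Lemma 3.5, after Bernstein–Hamilton–Weinkove).
Flat space, frame form.

* `hasDerivAt_covDeriv_of_heatType` — if a jointly smooth time-dependent section `Φ` satisfies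
  `∂ₜΦ = ∑ᵢDᵢDᵢΦ + Ψ` at time `t` along a solution of `∂ₜA = div F`, then
  `∂ₜ(D_wΦ) = ∑ᵢDᵢDᵢ(D_wΦ) + D_wΨ + 2∑ᵢ[F(w,bᵢ), DᵢΦ]`
  (the terms `[DᵢF(w,bᵢ), Φ]` and `[Ȧ_w, Φ]` cancel since `Ȧ = div F`);
* `deriv_sum_norm_sq_sub_laplacian_eq_of_heatType` — **Bochner identity** for a finite family
  of sections `G_α` with `∂ₜG_α = ∑ᵢDᵢDᵢG_α + Ψ_α` at `(t, x)` (`𝔲(m)`-valued connection):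
  `∂ₜ∑‖G_α‖² − ∑ₗ∂ₗ∂ₗ∑‖G_α‖² = −2∑‖D_lG_α‖² + 2∑⟨G_α, Ψ_α⟩`.

References: A. Waldron, Calc. Var. PDE 55 (2016), Lemma 3.1 [Waldron2016]; A. Waldron,
Invent. math. 217 (2019), Prop. 3.1 [Waldron2019].
-/

noncomputable section

open scoped ContDiff Topology RealInnerProductSpace Matrix
open Set Filter

namespace Literature.MathematicalPhysics.QuantumLattice

section HeatTypeEvolution

variable {E : Type*} [NormedAddCommGroup E] [InnerProductSpace ℝ E] [FiniteDimensional ℝ E]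
variable {𝔸 : Type*} [NormedRing 𝔸] [NormedAlgebra ℝ 𝔸]
variable {ι : Type*} [Fintype ι]

/-- Finite differentiability orders are below `∞`. [folklore] -/
private theorem natCast_le_infty₁₃ (n : ℕ) : (n : WithTop ℕ∞) ≤ ∞ := by exact_mod_cast le_top

/-- **Commuting `D_w` through the covariant heat operator along the flow.** Let `A` be jointly
smooth on `𝒯 × E` (`𝒯` open) with `∂ₜA = div_A F_A` on `𝒯`, let `Φ` be a jointly smooth
time-dependent section with `∂ₜΦ(·, y)|ₜ = ∑ᵢ DᵢDᵢΦ(t)(y) + Ψ(y)` for all `y` (`Ψ` differentiable),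
and `b` an orthonormal frame. Then at time `t`, for all `x w`,
`∂ₜ (D_wΦ)(x) = ∑ᵢ DᵢDᵢ(D_wΦ(t))(x) + D_wΨ(x) + 2∑ᵢ [F(w,bᵢ)(x), DᵢΦ(t)(x)]`.
[cite: Waldron2016, Lemma 3.1; Waldron2019, Prop. 3.1] -/
theorem hasDerivAt_covDeriv_of_heatType (b : OrthonormalBasis ι ℝ E)
    {A : ℝ → Connection E 𝔸} {𝒯 : Set ℝ} (h𝒯 : IsOpen 𝒯)
    (hA : ContDiffOn ℝ ∞ (fun p : ℝ × E => A p.1 p.2) (𝒯 ×ˢ (univ : Set E)))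
    (hpde : ∀ ⦃s : ℝ⦄, s ∈ 𝒯 → ∀ y w, deriv (fun s' => A s' y w) s = divCurvature (A s) y w)
    {t : ℝ} (ht : t ∈ 𝒯) {Φ : ℝ → E → 𝔸}
    (hΦ : ContDiffOn ℝ ∞ (fun p : ℝ × E => Φ p.1 p.2) (𝒯 ×ˢ (univ : Set E)))
    {Ψ : E → 𝔸} (hΨ : Differentiable ℝ Ψ)
    (hev : ∀ y, HasDerivAt (fun s => Φ s y)
      (∑ i, covDeriv (A t) (fun y' => covDeriv (A t) (Φ t) y' (b i)) y (b i) + Ψ y) t)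
    (x w : E) :
    HasDerivAt (fun s => covDeriv (A s) (Φ s) x w)
      (∑ i, covDeriv (A t) (fun y => covDeriv (A t)
          (fun z => covDeriv (A t) (Φ t) z w) y (b i)) x (b i) +
        (covDeriv (A t) Ψ x w +
          (2 : ℝ) • ∑ i, ⁅curvature (A t) x w (b i), covDeriv (A t) (Φ t) x (b i)⁆)) t := by
  have hU : IsOpen (𝒯 ×ˢ (univ : Set E)) := h𝒯.prod isOpen_univ
  have hp : ∀ y, (t, y) ∈ 𝒯 ×ˢ (univ : Set E) := fun y => ⟨ht, mem_univ y⟩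
  have hsm : ContDiff ℝ ∞ (A t) := contDiff_slice_of_contDiffOn_prod hA ht
  have hA1 : ContDiff ℝ 1 (A t) := hsm.of_le (natCast_le_infty₁₃ 1)
  have hA2 : ContDiff ℝ 2 (A t) := hsm.of_le (natCast_le_infty₁₃ 2)
  have hΦsm : ContDiff ℝ ∞ (Φ t) := by
    have : Φ t = (fun p : ℝ × E => Φ p.1 p.2) ∘ fun y : E => (t, y) := rfl
    rw [this]
    exact hΦ.comp_contDiff (contDiff_const.prodMk contDiff_id) fun y => hp y
  have hΦ3 : ContDiff ℝ 3 (Φ t) := hΦsm.of_le (natCast_le_infty₁₃ 3)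
  have hΦ2 : ContDiff ℝ 2 (Φ t) := hΦsm.of_le (natCast_le_infty₁₃ 2)
  have hDΦ2 : ∀ d, ContDiff ℝ 2 fun z => covDeriv (A t) (Φ t) z d := fun d => by
    have h21 : ContDiff ℝ (2 + 1) (Φ t) := by
      rw [show (2 : WithTop ℕ∞) + 1 = 3 by norm_num]; exact hΦ3
    exact contDiff_covDeriv_apply hA2 h21 d
  have hDDΦd : ∀ d d' y, DifferentiableAt ℝ
      (fun y' => covDeriv (A t) (fun z => covDeriv (A t) (Φ t) z d) y' d') y := fun d d' y =>
    differentiableAt_covDeriv_apply hA1 (hDΦ2 d) d' y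
  -- ### the time derivative `Ȧ(t) = div F`
  have hdiv : ∀ y a, fderiv ℝ (fun p : ℝ × E => A p.1 p.2) (t, y) ((1 : ℝ), (0 : E)) a =
      ∑ i, covDeriv (A t) (fun z => curvature (A t) z (b i) a) y (b i) := by
    intro y a
    have h := (hasDerivAt_slice_apply hU hA (by simp) (hp y) a).deriv
    rw [hpde ht y a] at h
    rw [← h, divCurvature_eq_sum_orthonormalBasis b (A t) hA2 y a]
  -- ### Step 1: `∂ₜ(D_wΦ) = D_w(∂ₜΦ) + [Ȧ_w, Φ]`
  have h1 := hasDerivAt_covDeriv_timeSlice hU hA hΦ (natCast_le_infty₁₃ 2) (hp x) w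
  -- ### Step 2: identify `∂ₜΦ(t, ·)`
  have hΦt : (fun y => fderiv ℝ (fun p : ℝ × E => Φ p.1 p.2) (t, y) ((1 : ℝ), (0 : E))) =
      fun y => ∑ i, covDeriv (A t) (fun y' => covDeriv (A t) (Φ t) y' (b i)) y (b i) + Ψ y := by
    funext y
    exact (hasDerivAt_timeSlice hU hΦ (by simp) (hp y)).unique (hev y)
  rw [hΦt] at h1
  refine h1.congr_deriv ?_
  -- ### Step 3: algebra
  have hsum_d : ∀ y, DifferentiableAt ℝ
      (fun y => ∑ i, covDeriv (A t) (fun y' => covDeriv (A t) (Φ t) y' (b i)) y (b i)) y :=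
    fun y => DifferentiableAt.fun_sum fun i _ => hDDΦd (b i) (b i) y
  rw [covDeriv_fun_add (A t) (hsum_d x) (hΨ x) w,
    covDeriv_sum_covDeriv_covDeriv_eq b (A t) hA2 hΦ3 x w]
  -- the cancellation `∑ᵢ [DᵢF(w,bᵢ), Φ] + [Ȧ_w, Φ] = 0`
  have hcancel : ∑ i, ⁅covDeriv (A t) (fun z => curvature (A t) z w (b i)) x (b i), Φ t x⁆ +
      ⁅fderiv ℝ (fun p : ℝ × E => A p.1 p.2) (t, x) ((1 : ℝ), (0 : E)) w, Φ t x⁆ = 0 := by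
    rw [hdiv x w]
    simp only [Ring.lie_def, Finset.sum_mul, Finset.mul_sum, ← Finset.sum_sub_distrib,
      ← Finset.sum_add_distrib]
    refine Finset.sum_eq_zero fun i _ => ?_
    rw [show (fun z => curvature (A t) z (b i) w) = fun z => -curvature (A t) z w (b i) from
      funext fun z => curvature_antisymm (A t) z (b i) w, covDeriv_fun_neg]
    noncomm_ring
  rw [eq_neg_of_add_eq_zero_right hcancel]
  simp only [Finset.smul_sum, Finset.sum_add_distrib]
  abel

end HeatTypeEvolution

/-! ### The Bochner identity for a family of heat-type sections -/

section HeatTypeBochner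

open scoped Matrix.Norms.Frobenius

attribute [local instance] frobeniusInnerProductSpace

variable {m : Type*} [Fintype m] [DecidableEq m]
variable {E : Type*} [NormedAddCommGroup E] [InnerProductSpace ℝ E] [FiniteDimensional ℝ E]
variable {ι : Type*} [Fintype ι] [LinearOrder ι]

omit [FiniteDimensional ℝ E] [LinearOrder ι] in
/-- **Bochner identity for a family of heat-type sections.** Let `A(t)` be a `C¹` `𝔲(m)`-valued
connection and `G_α` (`α ∈ κ`, finite) time-dependent sections, `C²` in space at time `t`, with
`∂ₜ G_α(·, x)|ₜ = ∑ᵢ DᵢDᵢG_α(t)(x) + Ψ_α` at the point `x`. Then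
`∂ₜ ∑_α ‖G_α(·, x)‖² |ₜ − ∑ₗ∂ₗ∂ₗ (∑_α ‖G_α(t)‖²)(x) = −2∑ₗ∑_α ‖D_lG_α(t)(x)‖² + 2∑_α ⟨G_α(t)(x), Ψ_α⟩`.
[cite: Waldron2016, Lemma 3.1; Waldron2019, Prop. 3.1] -/
theorem deriv_sum_norm_sq_sub_laplacian_eq_of_heatType {κ : Type*} [Fintype κ]
    (b : OrthonormalBasis ι ℝ E) {A : Connection E (Matrix m m ℂ)} (hA : ContDiff ℝ 1 A)
    (hval : A.IsValuedIn (skewAdjoint.submodule ℝ (Matrix m m ℂ)))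
    {G : κ → ℝ → E → Matrix m m ℂ} {t : ℝ} (hG : ∀ a, ContDiff ℝ 2 (G a t)) (x : E)
    {Ψ : κ → Matrix m m ℂ}
    (hev : ∀ a, HasDerivAt (fun s => G a s x)
      (∑ i, covDeriv A (fun y => covDeriv A (G a t) y (b i)) x (b i) + Ψ a) t) :
    deriv (fun s => ∑ a, ‖G a s x‖ ^ 2) t -
        ∑ l, fderiv ℝ (fun y => fderiv ℝ (fun z => ∑ a, ‖G a t z‖ ^ 2) y (b l)) x (b l) =
      -(2 * ∑ l, ∑ a, ‖covDeriv A (G a t) x (b l)‖ ^ 2) + 2 * ∑ a, ⟪G a t x, Ψ a⟫ := by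
  have hH : HasDerivAt (fun s => ∑ a, ‖G a s x‖ ^ 2)
      (∑ a, 2 * ⟪G a t x, ∑ i, covDeriv A (fun y => covDeriv A (G a t) y (b i)) x (b i) + Ψ a⟫) t :=
    HasDerivAt.fun_sum fun a _ => (hev a).norm_sq
  rw [hH.deriv, sum_fderiv_fderiv_sum_norm_sq_eq b hA hval (ψ := fun a => G a t) hG x]
  have e1 : ∑ a, 2 * ⟪G a t x, ∑ i, covDeriv A (fun y => covDeriv A (G a t) y (b i)) x (b i) + Ψ a⟫ =
      2 * (∑ l, ∑ a, ⟪G a t x, covDeriv A (fun y => covDeriv A (G a t) y (b l)) x (b l)⟫) +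
        2 * ∑ a, ⟪G a t x, Ψ a⟫ := by
    simp only [inner_add_right, inner_sum, mul_add, Finset.sum_add_distrib, ← Finset.mul_sum]
    rw [Finset.sum_comm]
  rw [e1]
  ring

end HeatTypeBochner

end Literature.MathematicalPhysics.QuantumLattice
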